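import Summits.AtomisticToContinuum.FouriersLaw.Theorems.BondHeatUncertaintyExtensiveSnapshotIrreversibilityEnergyWindowCostateTransfer
import Summits.AtomisticToContinuum.FouriersLaw.Theorems.BondHeatUncertaintyExtensiveSnapshotIrreversibilityEnergyWindowCostateSamplingFloor
import Summits.AtomisticToContinuum.FouriersLaw.Theorems.BondHeatUncertaintyExtensiveSnapshotIrreversibilityEnergyWindowCostateHarmonic
import HarnessLib

/-!
(SPLIT FOR THE 400-LINE CAP by the landing lane, hand-2 g32: this file = part 1 of 2; sequels `…BondHeatUncertaintyExtensiveSnapshotIrreversibilityEnergyWindowCostateObservability` import it in a chain; same namespace, all FQNs unchanged.)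
# Bond heat uncertainty — energy window: the costate observability floor (COF) — PROOF
  (the open leaf beneath (MC∞) `SkeletonGramLimitInverseMoments`, closed by the site transfer)

Cell `decomp-a2c`, lens-1 «grading / quantitative ladder», generation 84, crux
`stmt-AtomisticToContinuum-9121` (`ExtensiveSnapshotIrreversibility`, K_fix half, leaf S3), part T
(imports parts S `…CostateTransfer`, K `…CostateSamplingFloor`, L `…CostateHarmonic` + HarnessLib).

**Theorem (`costateObservabilityFloor`).** `CostateObservabilityFloor` holds: for the pinned
anharmonic chain (`ω₂, lam, β, γ > 0`) driven at both ends at temperatures `T ± δ/2`, every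
`N ≥ 2`, there are `μ = μ(N) > 0` and `δ₀ > 0` such that for every `θ > 0` some `K = K(θ) > 0`
satisfies, for every `|δ| < δ₀`, `s ∈ [1/2, 1]`, every initial state `z`, every pair of Wiener
paths `wp` and every path costate `c` on `[0, s]`,
`dualPair (c s) (c s) ≤ K · Θ_θ(z, wp)^μ · ∫₀ˢ β_0(r)² dr`  (`β_0 = (c r).2 0`, the observed
coordinate; `Θ_θ = ∫₀¹ e^{θ H(Φ_u(z, B))} du` the energy budget of part I-A).

Proof = the SITE TRANSFER of memo NODE-g84 §5 with natural-number exponents throughout.  Put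
`n = ‖c(s)‖`, `S = K₁ Θ n` (part M, `μ₀ = 1`), `Λ = C_Λ Θ` (part Q), `W = C_W Θ²` a master
constant dominating `16, 2γ, NΛ, 8(1+2γ)S/n, (NΛ + 2γ(1+2γ))S/n, √A_α S/n`, and a free parameter
`η ∈ [0, 1]`.  HYPOTHESIS: `∫₀ˢ β_0² ≤ (n η^{9^N})²`.  Then (§3, induction over the sites `k`):
`sup_{[0,s]} |β_i| ≤ W^{4k+1} n η^{6·9^{N-1-k}}` for all `i ≤ k` — base by (T0) (part S),
step `k → k+1` by the chain (TA) ⟹ (TD) ⟹ (TB) ⟹ (TC) of part S, each cube root dividing the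
`η`-exponent by `3` and each link raising the `W`-power by one (§1: `le_of_cube_small`,
`le_of_base_small`).  After the last site one more (TA)+(TD) gives `sup |α_i|, sup |β_i| ≤
W^{4N-1} n η²`, hence `n ≤ W^{4N-1} η² n` (§4).  Choosing `η = η₀ = 1/(2W^{4N-1})` the
hypothesis must FAIL unless `n = 0`; so `n² ≤ (2W^{4N-1})^{2·9^N} ∫₀ˢ β_0²`, i.e. the floor
with `μ = 4(4N-1)·9^N`, `δ₀ = 1` and `K = (2N+1) (2 C_W^{4N-1})^{2·9^N}` (§5: the real
arithmetic is isolated in `master_dominations` and `sq_le_of_transfer`).  No probability, no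
small parameter other than `η`, every exponent a natural number; the budget enters only
through parts M and Q.  Corollaries: `energyBudgetGramFloor_proved` (EBF) and
`skeletonGramLimitInverseMoments_proved` — (MC∞), the binder of record, is PROVED.

References: parts I-A, J, L (`dualPair_self_le`), M (`IsPathCostate.norm_le_budget`), Q
(`abs_hessPotential_solMap_le`), S (the links); memo NODE-g84 §5.
-/

namespace Summit.AtomisticToContinuum.FouriersLaw.Theorems.ExtensiveSnapshotIrreversibility.EnergyWindow

open MeasureTheory Filter Topology Set Finset
open scoped Nat
open Literature.MathematicalPhysics.KineticTheory.HeatConduction Literature.Probability.Process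

/-! ## 1. The two absorption lemmas (pure real arithmetic) -/

/-- **Cube-root link.**  From `x³ ≤ 16 u M² ∨ x s ≤ 8 u` (an interpolation move), `s ≥ 1/2`,
the current bound `u ≤ W^p n η^{3e}` and `M² ≤ W² n²` (`W ≥ 16`, `η ≤ 1`):
`x ≤ W^{p+1} n η^e`. [folklore] -/
theorem le_of_cube_small {x u Msq W n η s : ℝ} {p e : ℕ} (hx : 0 ≤ x) (hW : 16 ≤ W)
    (hn : 0 ≤ n) (hη0 : 0 ≤ η) (hη1 : η ≤ 1) (hs : 1 / 2 ≤ s) (hMsq0 : 0 ≤ Msq)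
    (h : x ^ 3 ≤ 16 * u * Msq ∨ x * s ≤ 8 * u) (hu : u ≤ W ^ p * n * η ^ (3 * e))
    (hM : Msq ≤ W ^ 2 * n ^ 2) : x ≤ W ^ (p + 1) * n * η ^ e := by
  have hW1 : 1 ≤ W := by linarith
  have hW0 : 0 ≤ W := by linarith
  have hδ : 0 ≤ W ^ (p + 1) * n * η ^ e := by positivity
  have hηe : η ^ (3 * e) ≤ η ^ e := pow_le_pow_of_le_one hη0 hη1 (by omega : e ≤ 3 * e)
  rcases h with h | h
  · refine le_of_pow_le_pow_left₀ (by norm_num) hδ (h.trans ?_)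
    calc 16 * u * Msq ≤ 16 * (W ^ p * n * η ^ (3 * e)) * (W ^ 2 * n ^ 2) := by
          have h1 : 16 * u * Msq ≤ 16 * (W ^ p * n * η ^ (3 * e)) * Msq :=
            mul_le_mul_of_nonneg_right (by linarith) hMsq0
          exact h1.trans (mul_le_mul_of_nonneg_left hM (by positivity))
      _ = 16 * W ^ (p + 2) * n ^ 3 * η ^ (3 * e) := by ring
      _ ≤ W * W ^ (p + 2) * n ^ 3 * η ^ (3 * e) := by gcongr
      _ = W ^ (p + 3) * n ^ 3 * η ^ (3 * e) := by ring
      _ ≤ W ^ (3 * p + 3) * n ^ 3 * η ^ (3 * e) := by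
          have hWp : W ^ (p + 3) ≤ W ^ (3 * p + 3) := pow_le_pow_right₀ hW1 (by omega)
          gcongr
      _ = (W ^ (p + 1) * n * η ^ e) ^ 3 := by ring
  · have h2 : x ≤ 16 * u := by nlinarith
    calc x ≤ 16 * u := h2
      _ ≤ 16 * (W ^ p * n * η ^ (3 * e)) := by linarith
      _ ≤ W * (W ^ p * n * η ^ (3 * e)) := by gcongr
      _ = W ^ (p + 1) * n * η ^ (3 * e) := by ring
      _ ≤ W ^ (p + 1) * n * η ^ e := by gcongr

/-- **Base link.**  From `x³ ≤ 8 L I ∨ x² s ≤ 8 I` (the move (C2a)), `s ≥ 1/2`, `8 L ≤ W n` and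
the observation hypothesis `I ≤ (n η^{3e})²` (`W ≥ 16`, `η ≤ 1`): `x ≤ W n η^{2e}`. [folklore] -/
theorem le_of_base_small {x L I W n η s : ℝ} {e : ℕ} (hW : 16 ≤ W) (hn : 0 ≤ n)
    (hη0 : 0 ≤ η) (hη1 : η ≤ 1) (hs : 1 / 2 ≤ s) (hI0 : 0 ≤ I)
    (h : x ^ 3 ≤ 8 * L * I ∨ x ^ 2 * s ≤ 8 * I) (hL : 8 * L ≤ W * n)
    (hI : I ≤ (n * η ^ (3 * e)) ^ 2) : x ≤ W * n * η ^ (2 * e) := by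
  have hW1 : 1 ≤ W := by linarith
  have hW0 : 0 ≤ W := by linarith
  have hδ : 0 ≤ W * n * η ^ (2 * e) := by positivity
  rcases h with h | h
  · refine le_of_pow_le_pow_left₀ (by norm_num) hδ (h.trans ?_)
    calc 8 * L * I ≤ W * n * I := mul_le_mul_of_nonneg_right hL hI0
      _ ≤ W * n * (n * η ^ (3 * e)) ^ 2 := mul_le_mul_of_nonneg_left hI (by positivity)
      _ = W * n ^ 3 * η ^ (6 * e) := by ring
      _ ≤ W ^ 3 * n ^ 3 * η ^ (6 * e) := by
          gcongr
          exact le_self_pow₀ hW1 (by norm_num)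
      _ = (W * n * η ^ (2 * e)) ^ 3 := by ring
  · refine le_of_pow_le_pow_left₀ (by norm_num : (2 : ℕ) ≠ 0) hδ ?_
    have h2 : x ^ 2 ≤ 16 * I := by nlinarith
    have hηe : η ^ (6 * e) ≤ η ^ (4 * e) :=
      pow_le_pow_of_le_one hη0 hη1 (by omega : 4 * e ≤ 6 * e)
    have h16 : (16 : ℝ) ≤ W ^ 2 := by nlinarith
    calc x ^ 2 ≤ 16 * I := h2
      _ ≤ 16 * (n * η ^ (3 * e)) ^ 2 := by linarith
      _ = 16 * n ^ 2 * η ^ (6 * e) := by ring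
      _ ≤ W ^ 2 * n ^ 2 * η ^ (4 * e) := by gcongr
      _ = (W * n * η ^ (2 * e)) ^ 2 := by ring

/-- Sup-norm of a phase-space point from coordinate bounds. [folklore] -/
theorem norm_le_of_abs_apply_le {N : ℕ} (x : PhaseSpace N) {r : ℝ} (hr : 0 ≤ r)
    (h1 : ∀ j, |x.1 j| ≤ r) (h2 : ∀ i, |x.2 i| ≤ r) : ‖x‖ ≤ r := by
  rw [Prod.norm_def, max_le_iff, pi_norm_le_iff_of_nonneg hr, pi_norm_le_iff_of_nonneg hr]
  exact ⟨fun j => by rw [Real.norm_eq_abs]; exact h1 j,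
    fun i => by rw [Real.norm_eq_abs]; exact h2 i⟩

section Links

variable {ω₂ lam β γ : ℝ} {N : ℕ} {T_L T_R : ℝ}

/-! ## 2. The links of the chain with natural-number exponents -/

/-- (T0-link) observation to sup at the observed site: `∫₀ˢ β_i² ≤ (n η^{3e})²`, `8(1+2γ)S ≤ W n`
⟹ `sup |β_i| ≤ W n η^{2e}`. [NEW · rung beneath (COF)] -/
theorem IsPathCostate.abs_snd_le_base (hγ : 0 ≤ γ) {s : ℝ} (hs : 1 / 2 ≤ s)
    {z : PhaseSpace N} {wp : WienerPair} {c : ℝ → PhaseSpace N}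
    (hc : IsPathCostate ω₂ lam β γ N T_L T_R s z wp c) {S W η : ℝ} (hS0 : 0 ≤ S)
    (hS : ∀ t ∈ Icc 0 s, ‖c t‖ ≤ S) (hW : 16 ≤ W) (hη0 : 0 ≤ η) (hη1 : η ≤ 1)
    (hWS : 8 * ((1 + 2 * γ) * S) ≤ W * ‖c s‖) (i : Fin N) {e : ℕ}
    (hI : ∫ u in (0 : ℝ)..s, ((c u).2 i) ^ 2 ≤ (‖c s‖ * η ^ (3 * e)) ^ 2) {t : ℝ}
    (ht : t ∈ Icc 0 s) : |(c t).2 i| ≤ W * ‖c s‖ * η ^ (2 * e) := by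
  have hs0 : 0 < s := by linarith
  have hI0 : 0 ≤ ∫ u in (0 : ℝ)..s, ((c u).2 i) ^ 2 :=
    intervalIntegral.integral_nonneg hs0.le fun u _ => sq_nonneg _
  exact le_of_base_small hW (norm_nonneg _) hη0 hη1 hs hI0
    (hc.abs_snd_pow_three_le_of_integral_sq hγ hs0 hS0 hS i ht) hWS hI

/-- (TA-link) `sup |β_i| ≤ W^p n η^{3e}` ⟹ `sup |β̇_i| ≤ W^{p+1} n η^e`.
[NEW · rung beneath (COF)] -/
theorem IsPathCostate.abs_betaDot_le_link (hγ : 0 ≤ γ) {s : ℝ} (hs : 1 / 2 ≤ s) (hs1 : s ≤ 1)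
    {z : PhaseSpace N} {wp : WienerPair} {c : ℝ → PhaseSpace N}
    (hc : IsPathCostate ω₂ lam β γ N T_L T_R s z wp c) {S Λ W η : ℝ} (hS0 : 0 ≤ S)
    (hS : ∀ t ∈ Icc 0 s, ‖c t‖ ≤ S) (hΛ0 : 0 ≤ Λ)
    (hΛ : ∀ t ∈ Icc 0 s, ∀ i j, |(pinnedChain ω₂ lam β γ).hessPotential N i j
      ((pinnedChain ω₂ lam β γ).solMap N T_L T_R t z (pairPath wp)).1| ≤ Λ)
    (hW : 16 ≤ W) (hη0 : 0 ≤ η) (hη1 : η ≤ 1)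
    (hWM : (((N : ℝ) * Λ + 2 * γ * (1 + 2 * γ)) * S) ^ 2 ≤ W ^ 2 * ‖c s‖ ^ 2)
    (i : Fin N) {p e : ℕ} (hB : ∀ t ∈ Icc 0 s, |(c t).2 i| ≤ W ^ p * ‖c s‖ * η ^ (3 * e))
    {t : ℝ} (ht : t ∈ Icc 0 s) :
    |-(c t).1 i + γ * OscillatorChain.bathWeight N i * (c t).2 i| ≤
      W ^ (p + 1) * ‖c s‖ * η ^ e := by
  have hs0 : 0 < s := by linarith
  exact le_of_cube_small (abs_nonneg _) hW (norm_nonneg _) hη0 hη1 hs (sq_nonneg _)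
    (hc.abs_betaDot_pow_three_le hγ hs0 hs1 hS0 hS hΛ0 hΛ i hB ht) le_rfl hWM

/-- (TD-link) `|β_i| ≤ W^p n η^{3e}`, `|β̇_i| ≤ W^{p+1} n η^e`, `2γ ≤ W` ⟹ `|α_i| ≤ W^{p+2} n η^e`
(the exponent is spelled `p + 1 + 1` so that the links compose syntactically).
[NEW · rung beneath (COF)] -/
theorem abs_fst_le_link (hγ : 0 ≤ γ) (x : PhaseSpace N) {W n η : ℝ} (hW : 16 ≤ W)
    (hn : 0 ≤ n) (hη0 : 0 ≤ η) (hη1 : η ≤ 1) (hWγ : 2 * γ ≤ W) (i : Fin N) {p e : ℕ}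
    (hB : |x.2 i| ≤ W ^ p * n * η ^ (3 * e))
    (hD : |-x.1 i + γ * OscillatorChain.bathWeight N i * x.2 i| ≤ W ^ (p + 1) * n * η ^ e) :
    |x.1 i| ≤ W ^ (p + 1 + 1) * n * η ^ e := by
  have hW1 : 1 ≤ W := by linarith
  have hW0 : 0 ≤ W := by linarith
  have hηe : η ^ (3 * e) ≤ η ^ e := pow_le_pow_of_le_one hη0 hη1 (by omega : e ≤ 3 * e)
  calc |x.1 i| ≤ |-x.1 i + γ * OscillatorChain.bathWeight N i * x.2 i| + 2 * γ * |x.2 i| :=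
        abs_fst_apply_le_abs_coDrift_snd_add hγ x i
    _ ≤ W ^ (p + 1) * n * η ^ e + W * (W ^ p * n * η ^ (3 * e)) :=
        add_le_add hD (mul_le_mul hWγ hB (abs_nonneg _) hW0)
    _ ≤ W ^ (p + 1) * n * η ^ e + W * (W ^ p * n * η ^ e) := by
        gcongr _ + W * ?_
        exact mul_le_mul_of_nonneg_left hηe (by positivity)
    _ = 2 * (W ^ (p + 1) * n * η ^ e) := by ring
    _ ≤ W * (W ^ (p + 1) * n * η ^ e) := by gcongr; linarith
    _ = W ^ (p + 1 + 1) * n * η ^ e := by ring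

/-- (TB-link) `sup |α_j| ≤ W^p n η^{3e}`, `A_α S² ≤ W² n²` ⟹ `sup |α̇_j| ≤ W^{p+1} n η^e`.
[NEW · rung beneath (COF)] -/
theorem IsPathCostate.abs_alphaDot_le_link (hω : 0 < ω₂) (hl : 0 ≤ lam) (hβ : 0 ≤ β)
    (hγ : 0 ≤ γ) {θ : ℝ} (hθ : 0 < θ) {s : ℝ} (hs : 1 / 2 ≤ s) (hs1 : s ≤ 1) {z : PhaseSpace N}
    {wp : WienerPair} {c : ℝ → PhaseSpace N} (hc : IsPathCostate ω₂ lam β γ N T_L T_R s z wp c)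
    {S Λ W η : ℝ} (hS0 : 0 ≤ S) (hS : ∀ t ∈ Icc 0 s, ‖c t‖ ≤ S)
    (hΛ : ∀ t ∈ Icc 0 s, ∀ i j, |(pinnedChain ω₂ lam β γ).hessPotential N i j
      ((pinnedChain ω₂ lam β γ).solMap N T_L T_R t z (pairPath wp)).1| ≤ Λ)
    (hW : 16 ≤ W) (hη0 : 0 ≤ η) (hη1 : η ≤ 1)
    (hWA : 2 * ((N : ℝ) * N) * ((1 + 2 * γ) ^ 2 * Λ ^ 2 +
        (6 * lam * (1 + 1 / ω₂) + (N : ℝ) * N * (24 * β)) ^ 2 * ((2 : ℝ) / θ ^ 2) *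
          energyBudget ω₂ lam β γ N T_L T_R θ z wp) * S ^ 2 ≤ W ^ 2 * ‖c s‖ ^ 2)
    (j : Fin N) {p e : ℕ} (hA : ∀ t ∈ Icc 0 s, |(c t).1 j| ≤ W ^ p * ‖c s‖ * η ^ (3 * e))
    {t : ℝ} (ht : t ∈ Icc 0 s) :
    |∑ i, (c t).2 i * (pinnedChain ω₂ lam β γ).hessPotential N i j
        ((pinnedChain ω₂ lam β γ).solMap N T_L T_R t z (pairPath wp)).1| ≤
      W ^ (p + 1) * ‖c s‖ * η ^ e := by
  have hs0 : 0 < s := by linarith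
  have hΘ : 0 ≤ energyBudget ω₂ lam β γ N T_L T_R θ z wp :=
    zero_le_one.trans (one_le_energyBudget (T_L := T_L) (T_R := T_R) hω hl hβ hγ hθ.le z wp)
  have hA0 : 0 ≤ 2 * ((N : ℝ) * N) * ((1 + 2 * γ) ^ 2 * Λ ^ 2 +
      (6 * lam * (1 + 1 / ω₂) + (N : ℝ) * N * (24 * β)) ^ 2 * ((2 : ℝ) / θ ^ 2) *
        energyBudget ω₂ lam β γ N T_L T_R θ z wp) * S ^ 2 := by positivity
  exact le_of_cube_small (abs_nonneg _) hW (norm_nonneg _) hη0 hη1 hs hA0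
    (hc.abs_alphaDot_pow_three_le hω hl hβ hγ hθ hs0 hs1 hS0 hS hΛ j hA ht) le_rfl hWA

/-- (TC-link) at a time `t`: `|β_i(t)| ≤ W^p n η^{27e}` for `i ≤ j`, `|α̇_j(t)| ≤ W^{p+3} n η^{3e}`,
`NΛ ≤ W` ⟹ `|β_{j+1}(t)| ≤ W^{p+4} n η^{3e}` (exponents spelled `p+1+1+1`, `p+1+1+1+1`).
[NEW · rung beneath (COF)] -/
theorem abs_snd_succ_le_link (hβ : 0 ≤ β) {q : Fin N → ℝ} {Λ W n η : ℝ}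
    (hΛ : ∀ i j, |(pinnedChain ω₂ lam β γ).hessPotential N i j q| ≤ Λ) (hW : 16 ≤ W)
    (hn : 0 ≤ n) (hη0 : 0 ≤ η) (hη1 : η ≤ 1) (hWΛ : (N : ℝ) * Λ ≤ W) (x : PhaseSpace N)
    {j j' : Fin N} (hj : j'.val = j.val + 1) {p e : ℕ}
    (hm : ∀ i : Fin N, i.val ≤ j.val → |x.2 i| ≤ W ^ p * n * η ^ (3 * (3 * (3 * e))))
    (hG : |∑ i, x.2 i * (pinnedChain ω₂ lam β γ).hessPotential N i j q| ≤
      W ^ (p + 1 + 1 + 1) * n * η ^ (3 * e)) :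
    |x.2 j'| ≤ W ^ (p + 1 + 1 + 1 + 1) * n * η ^ (3 * e) := by
  have hW1 : 1 ≤ W := by linarith
  have hW0 : 0 ≤ W := by linarith
  rw [show p + 1 + 1 + 1 = p + 3 by ring] at hG
  rw [show p + 1 + 1 + 1 + 1 = p + 4 by ring]
  have hηe : η ^ (3 * (3 * (3 * e))) ≤ η ^ (3 * e) :=
    pow_le_pow_of_le_one hη0 hη1 (by omega : 3 * e ≤ 3 * (3 * (3 * e)))
  have hWp : W ^ (p + 1) ≤ W ^ (p + 3) := pow_le_pow_right₀ hW1 (by omega)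
  calc |x.2 j'| ≤ |∑ i, x.2 i * (pinnedChain ω₂ lam β γ).hessPotential N i j q| +
        (N : ℝ) * (Λ * (W ^ p * n * η ^ (3 * (3 * (3 * e))))) := abs_snd_succ_le hβ hΛ x hj hm
    _ = |∑ i, x.2 i * (pinnedChain ω₂ lam β γ).hessPotential N i j q| +
        (N : ℝ) * Λ * (W ^ p * n * η ^ (3 * (3 * (3 * e)))) := by ring
    _ ≤ W ^ (p + 3) * n * η ^ (3 * e) + W * (W ^ p * n * η ^ (3 * e)) :=
        add_le_add hG (mul_le_mul hWΛ (mul_le_mul_of_nonneg_left hηe (by positivity))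
          (by positivity) hW0)
    _ = W ^ (p + 3) * n * η ^ (3 * e) + W ^ (p + 1) * n * η ^ (3 * e) := by ring
    _ ≤ W ^ (p + 3) * n * η ^ (3 * e) + W ^ (p + 3) * n * η ^ (3 * e) := by
        gcongr _ + ?_
        exact mul_le_mul_of_nonneg_right (mul_le_mul_of_nonneg_right hWp hn) (by positivity)
    _ = 2 * (W ^ (p + 3) * n * η ^ (3 * e)) := by ring
    _ ≤ W * (W ^ (p + 3) * n * η ^ (3 * e)) := by gcongr; linarith
    _ = W ^ (p + 4) * n * η ^ (3 * e) := by ring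

/-! ## 3. The induction over the sites -/

/-- **Site induction.**  Under the master-constant hypotheses and the observation hypothesis
`∫₀ˢ β_{i₀}² ≤ (n η^{9^N})²` at the bottom site `i₀ = 0`: for every `k < N`, every site `i ≤ k`
and every `t ∈ [0, s]`, `|β_i(t)| ≤ W^{4k+1} n η^{6·9^{N-1-k}}`. [NEW · the heart of (COF)] -/
theorem IsPathCostate.abs_snd_le_sites (hω : 0 < ω₂) (hl : 0 ≤ lam) (hβ : 0 ≤ β) (hγ : 0 ≤ γ)
    {θ : ℝ} (hθ : 0 < θ) {s : ℝ} (hs : 1 / 2 ≤ s) (hs1 : s ≤ 1) {z : PhaseSpace N}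
    {wp : WienerPair} {c : ℝ → PhaseSpace N} (hc : IsPathCostate ω₂ lam β γ N T_L T_R s z wp c)
    {S Λ W η : ℝ} (hS0 : 0 ≤ S) (hS : ∀ t ∈ Icc 0 s, ‖c t‖ ≤ S) (hΛ0 : 0 ≤ Λ)
    (hΛ : ∀ t ∈ Icc 0 s, ∀ i j, |(pinnedChain ω₂ lam β γ).hessPotential N i j
      ((pinnedChain ω₂ lam β γ).solMap N T_L T_R t z (pairPath wp)).1| ≤ Λ)
    (hW : 16 ≤ W) (hη0 : 0 ≤ η) (hη1 : η ≤ 1) (hWγ : 2 * γ ≤ W) (hWΛ : (N : ℝ) * Λ ≤ W)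
    (hWS : 8 * ((1 + 2 * γ) * S) ≤ W * ‖c s‖)
    (hWM : (((N : ℝ) * Λ + 2 * γ * (1 + 2 * γ)) * S) ^ 2 ≤ W ^ 2 * ‖c s‖ ^ 2)
    (hWA : 2 * ((N : ℝ) * N) * ((1 + 2 * γ) ^ 2 * Λ ^ 2 +
        (6 * lam * (1 + 1 / ω₂) + (N : ℝ) * N * (24 * β)) ^ 2 * ((2 : ℝ) / θ ^ 2) *
          energyBudget ω₂ lam β γ N T_L T_R θ z wp) * S ^ 2 ≤ W ^ 2 * ‖c s‖ ^ 2)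
    {i₀ : Fin N} (hi₀ : i₀.val = 0)
    (hI : ∫ u in (0 : ℝ)..s, ((c u).2 i₀) ^ 2 ≤ (‖c s‖ * η ^ (9 ^ N)) ^ 2) :
    ∀ k : ℕ, k < N → ∀ i : Fin N, i.val ≤ k → ∀ t ∈ Icc 0 s,
      |(c t).2 i| ≤ W ^ (4 * k + 1) * ‖c s‖ * η ^ (6 * 9 ^ (N - 1 - k)) := by
  have hW1 : 1 ≤ W := by linarith
  have hn : 0 ≤ ‖c s‖ := norm_nonneg _
  intro k
  induction k with
  | zero =>
    intro hk i hi t ht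
    have hii : i = i₀ := Fin.ext (by omega)
    subst hii
    have h9 : 9 ^ N = 3 * (3 * 9 ^ (N - 1)) := by
      conv_lhs => rw [← Nat.sub_add_cancel (show 1 ≤ N by omega), pow_succ]
      ring
    rw [h9] at hI
    have h := hc.abs_snd_le_base hγ hs hS0 hS hW hη0 hη1 hWS i hI ht
    rw [show 4 * 0 + 1 = 1 by ring, pow_one,
      show 6 * 9 ^ (N - 1 - 0) = 2 * (3 * 9 ^ (N - 1)) by rw [Nat.sub_zero]; ring]
    exact h
  | succ k ih =>
    intro hk i hi t ht
    have ih' := ih (by omega)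
    -- exponent bookkeeping: `6·9^{N-1-k} = 27 e`, `6·9^{N-1-(k+1)} = 3 e`, `e = 2·9^{N-1-(k+1)}`
    have hd : N - 1 - k = N - 1 - (k + 1) + 1 := by omega
    have he : 6 * 9 ^ (N - 1 - k) = 3 * (3 * (3 * (2 * 9 ^ (N - 1 - (k + 1))))) := by
      rw [hd, pow_succ]; ring
    have he' : 6 * 9 ^ (N - 1 - (k + 1)) = 3 * (2 * 9 ^ (N - 1 - (k + 1))) := by ring
    have hp : 4 * (k + 1) + 1 = 4 * k + 1 + 1 + 1 + 1 + 1 := by ring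
    rw [he', hp]
    -- the sites `≤ k`
    have hB : ∀ i : Fin N, i.val ≤ k → ∀ t ∈ Icc 0 s, |(c t).2 i| ≤
        W ^ (4 * k + 1) * ‖c s‖ * η ^ (3 * (3 * (3 * (2 * 9 ^ (N - 1 - (k + 1)))))) := by
      intro i hi t ht
      have h := ih' i hi t ht
      rwa [he] at h
    -- the chain at site `j = k`
    set j : Fin N := ⟨k, by omega⟩ with hjdef
    set j' : Fin N := ⟨k + 1, hk⟩ with hj'def
    have hj : j'.val = j.val + 1 := rfl
    have hjk : j.val ≤ k := le_rfl
    have hD : ∀ t ∈ Icc 0 s, |-(c t).1 j + γ * OscillatorChain.bathWeight N j * (c t).2 j| ≤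
        W ^ (4 * k + 1 + 1) * ‖c s‖ * η ^ (3 * (3 * (2 * 9 ^ (N - 1 - (k + 1))))) :=
      fun t ht => hc.abs_betaDot_le_link hγ hs hs1 hS0 hS hΛ0 hΛ hW hη0 hη1 hWM j (hB j hjk) ht
    have hA : ∀ t ∈ Icc 0 s, |(c t).1 j| ≤
        W ^ (4 * k + 1 + 1 + 1) * ‖c s‖ * η ^ (3 * (3 * (2 * 9 ^ (N - 1 - (k + 1))))) :=
      fun t ht => abs_fst_le_link hγ (c t) hW hn hη0 hη1 hWγ j (hB j hjk t ht) (hD t ht)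
    have hG : ∀ t ∈ Icc 0 s, |∑ i, (c t).2 i * (pinnedChain ω₂ lam β γ).hessPotential N i j
        ((pinnedChain ω₂ lam β γ).solMap N T_L T_R t z (pairPath wp)).1| ≤
        W ^ (4 * k + 1 + 1 + 1 + 1) * ‖c s‖ * η ^ (3 * (2 * 9 ^ (N - 1 - (k + 1)))) :=
      fun t ht => hc.abs_alphaDot_le_link hω hl hβ hγ hθ hs hs1 hS0 hS hΛ hW hη0 hη1 hWA j hA ht
    -- site `k + 1` by the pointwise solve, the sites `≤ k` by monotonicity
    by_cases hik : i.val ≤ k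
    · have h := hB i hik t ht
      refine h.trans ?_
      have hηe : η ^ (3 * (3 * (3 * (2 * 9 ^ (N - 1 - (k + 1)))))) ≤
          η ^ (3 * (2 * 9 ^ (N - 1 - (k + 1)))) := pow_le_pow_of_le_one hη0 hη1 (by omega)
      have hWp : W ^ (4 * k + 1) ≤ W ^ (4 * k + 1 + 1 + 1 + 1 + 1) :=
        pow_le_pow_right₀ hW1 (by omega)
      exact mul_le_mul (mul_le_mul_of_nonneg_right hWp hn) hηe (by positivity) (by positivity)
    · have hii : i = j' := Fin.ext (by rw [show j'.val = k + 1 from rfl]; omega)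
      rw [hii]
      exact abs_snd_succ_le_link hβ (hΛ t ht) hW hn hη0 hη1 hWΛ (c t) hj
        (fun i hi => hB i hi t ht) (hG t ht)

/-! ## 4. After the last site: the whole costate at time `s` -/

/-- **Transfer conclusion.**  Under the master-constant hypotheses and
`∫₀ˢ β_0² ≤ (‖c(s)‖ η^{9^N})²`: `‖c(s)‖ ≤ W^{4(N-1)+3} ‖c(s)‖ η²`. [NEW · the heart of (COF)] -/
theorem IsPathCostate.norm_le_of_integral_sq_le (hω : 0 < ω₂) (hl : 0 ≤ lam) (hβ : 0 ≤ β)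
    (hγ : 0 ≤ γ) {θ : ℝ} (hθ : 0 < θ) {s : ℝ} (hs : 1 / 2 ≤ s) (hs1 : s ≤ 1) {z : PhaseSpace N}
    {wp : WienerPair} {c : ℝ → PhaseSpace N} (hc : IsPathCostate ω₂ lam β γ N T_L T_R s z wp c)
    {S Λ W η : ℝ} (hS0 : 0 ≤ S) (hS : ∀ t ∈ Icc 0 s, ‖c t‖ ≤ S) (hΛ0 : 0 ≤ Λ)
    (hΛ : ∀ t ∈ Icc 0 s, ∀ i j, |(pinnedChain ω₂ lam β γ).hessPotential N i j
      ((pinnedChain ω₂ lam β γ).solMap N T_L T_R t z (pairPath wp)).1| ≤ Λ)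
    (hW : 16 ≤ W) (hη0 : 0 ≤ η) (hη1 : η ≤ 1) (hWγ : 2 * γ ≤ W) (hWΛ : (N : ℝ) * Λ ≤ W)
    (hWS : 8 * ((1 + 2 * γ) * S) ≤ W * ‖c s‖)
    (hWM : (((N : ℝ) * Λ + 2 * γ * (1 + 2 * γ)) * S) ^ 2 ≤ W ^ 2 * ‖c s‖ ^ 2)
    (hWA : 2 * ((N : ℝ) * N) * ((1 + 2 * γ) ^ 2 * Λ ^ 2 +
        (6 * lam * (1 + 1 / ω₂) + (N : ℝ) * N * (24 * β)) ^ 2 * ((2 : ℝ) / θ ^ 2) *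
          energyBudget ω₂ lam β γ N T_L T_R θ z wp) * S ^ 2 ≤ W ^ 2 * ‖c s‖ ^ 2)
    {i₀ : Fin N} (hi₀ : i₀.val = 0)
    (hI : ∫ u in (0 : ℝ)..s, ((c u).2 i₀) ^ 2 ≤ (‖c s‖ * η ^ (9 ^ N)) ^ 2) :
    ‖c s‖ ≤ W ^ (4 * (N - 1) + 1 + 1 + 1) * ‖c s‖ * η ^ 2 := by
  have hW1 : 1 ≤ W := by linarith
  have hn : 0 ≤ ‖c s‖ := norm_nonneg _
  have hN : 1 ≤ N := by have := i₀.isLt; omega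
  have hs' : s ∈ Icc 0 s := ⟨by linarith, le_rfl⟩
  have hsites := hc.abs_snd_le_sites hω hl hβ hγ hθ hs hs1 hS0 hS hΛ0 hΛ hW hη0 hη1 hWγ hWΛ hWS
    hWM hWA hi₀ hI (N - 1) (by omega)
  have h6 : 6 * 9 ^ (N - 1 - (N - 1)) = 3 * 2 := by rw [Nat.sub_self, pow_zero]; norm_num
  have hB : ∀ i : Fin N, ∀ t ∈ Icc 0 s, |(c t).2 i| ≤
      W ^ (4 * (N - 1) + 1) * ‖c s‖ * η ^ (3 * 2) := by
    intro i t ht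
    have h := hsites i (by have := i.isLt; omega) t ht
    rwa [h6] at h
  have hD : ∀ i : Fin N, ∀ t ∈ Icc 0 s,
      |-(c t).1 i + γ * OscillatorChain.bathWeight N i * (c t).2 i| ≤
        W ^ (4 * (N - 1) + 1 + 1) * ‖c s‖ * η ^ 2 :=
    fun i t ht => hc.abs_betaDot_le_link hγ hs hs1 hS0 hS hΛ0 hΛ hW hη0 hη1 hWM i (hB i) ht
  have hA : ∀ i : Fin N, ∀ t ∈ Icc 0 s, |(c t).1 i| ≤
      W ^ (4 * (N - 1) + 1 + 1 + 1) * ‖c s‖ * η ^ 2 :=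
    fun i t ht => abs_fst_le_link hγ (c t) hW hn hη0 hη1 hWγ i (e := 2) (hB i t ht) (hD i t ht)
  refine norm_le_of_abs_apply_le (c s) (by positivity) (fun j => hA j s hs') (fun i => ?_)
  refine (hB i s hs').trans ?_
  have hηe : η ^ (3 * 2) ≤ η ^ 2 := pow_le_pow_of_le_one hη0 hη1 (by omega)
  have hWp : W ^ (4 * (N - 1) + 1) ≤ W ^ (4 * (N - 1) + 1 + 1 + 1) :=
    pow_le_pow_right₀ hW1 (by omega)
  exact mul_le_mul (mul_le_mul_of_nonneg_right hWp hn) hηe (by positivity) (by positivity)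

end Links

end Summit.AtomisticToContinuum.FouriersLaw.Theorems.ExtensiveSnapshotIrreversibility.EnergyWindow
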